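import Literature.AlgebraicGeometry.ComplexMultiplication.EndFieldTotallyRealOrCMOfRiemann
import Literature.AlgebraicGeometry.HodgeTheory.AbelianVarietyHodgeFullnessHolds
import Literature.AlgebraicGeometry.Motives.HodgeLieRealPlacesSl2
import Mathlib.NumberTheory.NumberField.InfinitePlace.TotallyRealComplex
import HarnessLib

/-!
# The Lie algebra of the Hodge group of a complex abelian variety with real multiplication of relative dimension one is `𝔰𝔭_E(H¹, ψ)` (Hazama 1983 Thm. (1.1)/§3; Ribet 1983: `Hg(X) = R_{E/ℚ} SL₂`)

Family `hodge`, layer `Literature/AlgebraicGeometry/HodgeTheory`. Research context: cell `pub-hodge-ring2`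
(HONEST FRAMING: a research route conditional on HC_CM; not a corollary; Q11.4-sentence-2 already refuted
in dim ≥ 3), Literature lane, real-multiplication programme R2 — this file is the BRIDGE from abelian
varieties to the abstract theorem `Motives/HodgeLieRealPlacesSl2` (R2a). It is UNCONDITIONAL (Riemann's
theorem `deligneMilne1982_Thm_6_20_full_holds` is a tree theorem) and no step towards a summit statement.

SETTING. `B` a complex abelian variety whose endomorphism algebra `End⁰(B) = B.endAlgebra` is a FIELD
`E = EndField B hF` which is TOTALLY REAL with `[E : ℚ] = dim B` («type (1)» of Hazama 1983 §3 with
`n = s = 1`: `A` simple, `End⁰(A)` a totally real field of degree `g = dim A`; Ribet 1983: relative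
dimension `dim A / [E:ℚ] = 1`). `V = H¹(B(ℂ); ℚ)` (`Motives.bettiCohomology B.X 1`) with its weight-one
`ℚ`-Hodge structure `H = BettiUniverse.hodge hHD _ 1`, on which `E` acts by `e ↦ e^*`
(`ComplexMultiplication.hOneAlgHom`, `hOneEndAction`).

PROVED HERE (theorems; two auxiliary definitions of DATA — the identification
`E ≃ₐ[ℚ] End_Hdg(H¹)` and the characters of `End_Hdg(H¹)` attached to the embeddings `E → ℂ`; no named
fact, D-0026):

* §1 `mem_endAlg_hodge_one_iff` — RIEMANN: the Hodge endomorphisms of `H¹(B(ℂ); ℚ)` are exactly the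
  `e^*`, `e ∈ End⁰(B)` (fullness `deligneMilne1982_Thm_6_20_full_holds` + `hOneAlgHom_map_F_le`);
  `endFieldAlgEquivEndAlg : E ≃ₐ[ℚ] End_Hdg(H¹)`.
* §2 `isAdjointPair_self_of_isTotallyReal` — for `E` totally real EVERY Hodge endomorphism of `H¹` is
  self-adjoint for EVERY polarization `ψ` of `H¹` (the Rosati-type involution `e ↦ e'` of
  `EndFieldTotallyRealOrCMOfRiemann.exists_adjoint` satisfies `σ(e') = conj σ(e) = σ(e)` for a real
  embedding `σ`, `apply_eq_conj_of_isAdjointPair`; Shimura 1998 §5.1 Lemma 2 / Prop. 5).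
* §3 `hodgeCharacter τ : End_Hdg(H¹) → ℂ` for `τ : E → ℂ`; its eigenblock is the joint `τ`-eigenspace
  `V_τ = {x | e^*_ℂ x = τ(e) x}` (`eigenBlock_hodgeCharacter`); the `V_τ` form an INTERNAL DIRECT SUM
  `V_ℂ = ⊕_τ V_τ` (`isInternal_eigenBlock_hodgeCharacter`: independence through a primitive element,
  spanning through the tree's `EndAction.iSup_eigenPiece_holds`), each of dimension
  `dim_ℚ V / [E:ℚ] = 2 dim B / dim B = 2` (`finrank_eigenBlock_hodgeCharacter`, from
  `EndAction.finrank_iInf_eigenspace_mul_finrank`), and `hodgeCharacter τ` is real for `E` totally real.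
  (Hazama 1983 §3 p. 305: `H¹(A, ℂ) = V₁ ⊕ ⋯ ⊕ V_k`, «`dim_ℂ V_i = 2` for all `i`»; Deligne LNM 900 §4:
  `H¹_B ⊗ ℂ = ⊕_σ H¹_{B,σ}`.)
* §4 THE THEOREMS `mem_hodgeLie_hodge_one_iff_of_isTotallyReal`,
  `mem_hodgeLieC_hodge_one_iff_of_isTotallyReal`, `mem_hodgeLieC_hodge_one_iff_mapsTo_of_isTotallyReal`:
  for such `B` and ANY polarization `ψ` of `H¹(B(ℂ); ℚ)`,
  `Lie Hg(B) := (BettiUniverse.hodge _ _ 1).hodgeLie = {X ∈ End_ℚ H¹ : X e^* = e^* X (e ∈ E), ψ(Xv, w) + ψ(v, Xw) = 0} = 𝔰𝔭_E(H¹, ψ)`,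
  and `Lie Hg(B) ⊗ ℂ = ⊕_τ 𝔰𝔭(V_τ) = ⊕_τ 𝔰𝔩(V_τ)` — Hazama 1983 §3: «𝔥 = 𝔰𝔩₂ × ⋯ × 𝔰𝔩₂», Ribet 1983:
  `Hg = R_{E/ℚ} SL₂`; obtained by feeding §1–§3 to the tree theorem
  `HodgeStructure.mem_hodgeLie_iff_commute_and_skew` (`Motives/HodgeLieRealPlacesSl2`).

## References

* [Hazama1983] F. Hazama, *Algebraic cycles on abelian varieties with many real endomorphisms*, Tôhoku
  Math. J. 35 (1983) 303–308 (held `paper:doi-10-2748-tmj-1178229056`): Thm. (1.1) p. 303, §3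
  pp. 305–306. [cite: Hazama1983, Thm. (1.1) and §3 (pp. 305–306)]
* [Ribet1983] K. A. Ribet, *Hodge classes on certain types of abelian varieties*, Amer. J. Math. 105
  (1983) 523–538, Thm. 0–1. [cite: Ribet1983, Thm. 0–1]
* [DeligneMilne1982Tannakian] P. Deligne, J. S. Milne, *Tannakian Categories*, LNM 900 (1982), §6
  Thm. 6.20 (Riemann). [cite: DeligneMilne1982Tannakian, §6 Thm. 6.20]
* [Shimura1998] G. Shimura, *Abelian Varieties with Complex Multiplication and Modular Functions*
  (1998), §5.1 Lemma 2 and Prop. 5 (pp. 35–36). [cite: Shimura1998, §5.1 Lemma 2 and Proposition 5]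
* [Deligne1982HodgeCycles] P. Deligne, *Hodge cycles on abelian varieties*, LNM 900 (1982), §4 p. 30
  (`H¹_B ⊗ ℂ = ⊕_σ H¹_{B,σ}`). [cite: Deligne1982HodgeCycles, §4 p. 30]
* [MoonenZarhin1999LowDim] B. Moonen, Yu. Zarhin, Math. Ann. 315 (1999), §3 (3.1).
  [cite: MoonenZarhin1999LowDim, §3 (3.1)]
-/

noncomputable section

open scoped TensorProduct
open CategoryTheory Module NumberField

namespace Literature.AlgebraicGeometry.HodgeTheory

open Literature.AlgebraicGeometry.Motives Literature.AlgebraicGeometry.ComplexMultiplication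
open Literature.AlgebraicGeometry.Motives.HodgeStructure

section RealMultiplication

variable {B : AbelianVariety ℂ} (hF : IsField B.endAlgebra)

/-! ### §1 Riemann: the Hodge endomorphisms of `H¹(B(ℂ); ℚ)` are the `e^*`, `e ∈ End⁰(B)` -/

/-- **Riemann's theorem for `End`**: a `ℚ`-linear endomorphism of `H¹(B(ℂ); ℚ)` preserves the Hodge
filtration iff it is `e^*` for some `e ∈ End⁰(B)` (`→`: fullness of `H¹_B`,
`deligneMilne1982_Thm_6_20_full_holds`, gives `u^* = k • a` with `u : B → B`, `k ≥ 1`, so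
`a = (k⁻¹ ⊗ u)^*`; `←`: pull-backs preserve the Hodge filtration, `hOneAlgHom_map_F_le`).
[cite: DeligneMilne1982Tannakian, §6 Thm. 6.20] -/
theorem mem_endAlg_hodge_one_iff (hHD : exists_isReal_hodgeModel)
    (hI : hodgePQ_independent_of_hodgeModel) (a : Module.End ℚ (bettiCohomology B.X 1)) :
    a ∈ (BettiUniverse.hodge hHD (AbelianVariety.isSmoothProjective_holds (A := B)) 1).endAlg ↔
      ∃ e : EndField B hF, hOneAlgHom (EndField.toEndAlgebra hF).toRingHom e = a := by
  constructor
  · intro ha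
    obtain ⟨u, k, hk, hu⟩ := deligneMilne1982_Thm_6_20_full_holds B B a
      ⟨BettiUniverse.realHodgeModel hHD (AbelianVariety.isSmoothProjective_holds (A := B))⟩
      (isHodgeMorphismOne_of_map_F_le hHD hI a ha)
    refine ⟨(EndField.toEndAlgebra hF).symm
      (algebraMap ℚ B.endAlgebra ((k : ℚ)⁻¹) * AbelianVariety.endAlgebra.of B u), ?_⟩
    rw [hOneAlgHom_apply, RingEquiv.toRingHom_eq_coe, RingEquiv.coe_toRingHom,
      RingEquiv.apply_symm_apply, map_mul, AlgHom.commutes, bettiRep_of, Algebra.algebraMap_eq_smul_one,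
      smul_mul_assoc, one_mul, MulOpposite.unop_smul, MulOpposite.unop_op]
    refine LinearMap.ext fun x => ?_
    have hkx : (k : ℚ) • a x = bettiCohomology.map u.hom.hom.hom 1 x := by
      rw [hu x, Nat.cast_smul_eq_nsmul]
    rw [LinearMap.smul_apply, ← hkx, smul_smul, inv_mul_cancel₀ (by exact_mod_cast hk.ne'), one_smul]
  · rintro ⟨e, rfl⟩
    exact fun p => hOneAlgHom_map_F_le _ hHD hI e p

/-- The `ℚ`-algebra map `E = End⁰(B) → End_Hdg(H¹(B(ℂ); ℚ))`, `e ↦ e^*` (pull-backs preserve the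
Hodge filtration, `hOneAlgHom_map_F_le`). [cite: Deligne1982HodgeCycles, §4] -/
def endFieldAlgHomEndAlg (hHD : exists_isReal_hodgeModel) (hI : hodgePQ_independent_of_hodgeModel) :
    EndField B hF →ₐ[ℚ]
      (BettiUniverse.hodge hHD (AbelianVariety.isSmoothProjective_holds (A := B)) 1).endAlg :=
  (hOneAlgHom (EndField.toEndAlgebra hF).toRingHom).codRestrict
    (BettiUniverse.hodge hHD (AbelianVariety.isSmoothProjective_holds (A := B)) 1).endAlg
    fun e p => hOneAlgHom_map_F_le _ hHD hI e p

/-- `endFieldAlgHomEndAlg e` is `e^*` on underlying maps. [cite: Deligne1982HodgeCycles, §4] -/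
theorem coe_endFieldAlgHomEndAlg_apply (hHD : exists_isReal_hodgeModel)
    (hI : hodgePQ_independent_of_hodgeModel) (e : EndField B hF) :
    ((endFieldAlgHomEndAlg hF hHD hI e :
        (BettiUniverse.hodge hHD (AbelianVariety.isSmoothProjective_holds (A := B)) 1).endAlg) :
      Module.End ℚ (bettiCohomology B.X 1)) = hOneAlgHom (EndField.toEndAlgebra hF).toRingHom e :=
  rfl

/-- **`e ↦ e^*` is a bijection `End⁰(B) ≅ End_Hdg(H¹(B(ℂ); ℚ))`** (injective by the faithfulness of the
rational representation, `hOneAlgHom_endField_injective`; surjective by Riemann,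
`mem_endAlg_hodge_one_iff`). [cite: DeligneMilne1982Tannakian, §6 Thm. 6.20] -/
theorem endFieldAlgHomEndAlg_bijective (hHD : exists_isReal_hodgeModel)
    (hI : hodgePQ_independent_of_hodgeModel) :
    Function.Bijective (endFieldAlgHomEndAlg hF hHD hI) := by
  refine ⟨fun x y hxy => hOneAlgHom_endField_injective hF ?_, fun a => ?_⟩
  · rw [← coe_endFieldAlgHomEndAlg_apply hF hHD hI x, ← coe_endFieldAlgHomEndAlg_apply hF hHD hI y, hxy]
  · obtain ⟨e, he⟩ := (mem_endAlg_hodge_one_iff hF hHD hI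
      (a : Module.End ℚ (bettiCohomology B.X 1))).1 a.2
    exact ⟨e, Subtype.ext he⟩

/-- **`E = End⁰(B) ≃ End_Hdg(H¹(B(ℂ); ℚ))`** as `ℚ`-algebras (Riemann). [cite: DeligneMilne1982Tannakian, §6 Thm. 6.20] -/
def endFieldAlgEquivEndAlg (hHD : exists_isReal_hodgeModel) (hI : hodgePQ_independent_of_hodgeModel) :
    EndField B hF ≃ₐ[ℚ]
      (BettiUniverse.hodge hHD (AbelianVariety.isSmoothProjective_holds (A := B)) 1).endAlg :=
  AlgEquiv.ofBijective (endFieldAlgHomEndAlg hF hHD hI) (endFieldAlgHomEndAlg_bijective hF hHD hI)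

/-- The identification is `e ↦ e^*` on underlying maps. [cite: DeligneMilne1982Tannakian, §6 Thm. 6.20] -/
@[simp]
theorem coe_endFieldAlgEquivEndAlg_apply (hHD : exists_isReal_hodgeModel)
    (hI : hodgePQ_independent_of_hodgeModel) (e : EndField B hF) :
    ((endFieldAlgEquivEndAlg hF hHD hI e :
        (BettiUniverse.hodge hHD (AbelianVariety.isSmoothProjective_holds (A := B)) 1).endAlg) :
      Module.End ℚ (bettiCohomology B.X 1)) = hOneAlgHom (EndField.toEndAlgebra hF).toRingHom e :=
  rfl

/-! ### §2 For `E` totally real every Hodge endomorphism is self-adjoint for every polarization -/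

/-- A number field has positive degree over `ℚ` (instance path through `NumberField`). [folklore] -/
private theorem finrank_pos_of_numberField (E : Type*) [Field E] [NumberField E] :
    0 < Module.finrank ℚ E :=
  Module.finrank_pos

/-- A number field has a primitive element over `ℚ` (instance path through `NumberField`). [folklore] -/
private theorem exists_primitive_element_of_numberField (E : Type*) [Field E] [NumberField E] :
    ∃ α : E, IntermediateField.adjoin ℚ {α} = ⊤ :=
  Field.exists_primitive_element ℚ E

include hF in
/-- `End⁰(B)` has positive degree, so `dim B > 0` when `[End⁰(B) : ℚ] = dim B`. [folklore] -/
private theorem dim_pos_of_finrank_eq (hdeg : Module.finrank ℚ B.endAlgebra = B.dim) : 0 < B.dim := by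
  have h := finrank_pos_of_numberField (EndField B hF)
  rw [EndField.finrank_eq hF, hdeg] at h
  exact h

/-- **For `E = End⁰(B)` a totally real field, every Hodge endomorphism of `H¹(B(ℂ); ℚ)` is
self-adjoint for every polarization `ψ`** (the Rosati-type involution `e ↦ e'` of `ψ` on `E`,
`exists_adjoint`, satisfies `σ(e') = conj σ(e)` for every embedding `σ : E → ℂ`,
`apply_eq_conj_of_isAdjointPair`; all embeddings of a totally real field are real, so `e' = e` —
Shimura 1998 §5.1 Lemma 2 with Prop. 5: the involution is the identity on a totally real `K₀ = K`).
[cite: Shimura1998, §5.1 Lemma 2 and Proposition 5 (pp. 35–36)] [cite: DeligneMilne1982Tannakian, §6 Thm. 6.20] -/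
theorem isAdjointPair_self_of_isTotallyReal (hHD : exists_isReal_hodgeModel)
    (hI : hodgePQ_independent_of_hodgeModel) [IsTotallyReal (EndField B hF)] (hB0 : 0 < B.dim)
    (ψ : (BettiUniverse.hodge hHD (AbelianVariety.isSmoothProjective_holds (A := B)) 1).Polarization)
    (a : (BettiUniverse.hodge hHD (AbelianVariety.isSmoothProjective_holds (A := B)) 1).endAlg) :
    LinearMap.IsAdjointPair ψ.form ψ.form (a : Module.End ℚ (bettiCohomology B.X 1))
      (a : Module.End ℚ (bettiCohomology B.X 1)) := by
  obtain ⟨e, he⟩ := (mem_endAlg_hodge_one_iff hF hHD hI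
    (a : Module.End ℚ (bettiCohomology B.X 1))).1 a.2
  obtain ⟨e', he'⟩ := exists_adjoint hF hHD hI deligneMilne1982_Thm_6_20_full_holds ψ e
  obtain ⟨σ₀⟩ : Nonempty (EndField B hF →+* ℂ) := inferInstance
  have hreal : ComplexEmbedding.conjugate σ₀ = σ₀ :=
    ComplexEmbedding.isReal_iff.1 (IsTotallyReal.complexEmbedding_isReal σ₀)
  have h1 : σ₀ e' = σ₀ e := by
    rw [apply_eq_conj_of_isAdjointPair hF hHD hI hB0 ψ he' σ₀]
    have h2 := RingHom.congr_fun hreal e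
    rwa [ComplexEmbedding.conjugate_coe_eq] at h2
  have hee : e' = e := σ₀.injective h1
  rw [hee, he] at he'
  exact he'

/-! ### §3 The characters of `End_Hdg(H¹)` attached to the embeddings `E → ℂ`, their blocks -/

/-- The character `End_Hdg(H¹) ≅ E —τ→ ℂ` attached to an embedding `τ : E → ℂ`.
[cite: Deligne1982HodgeCycles, §4 p. 30] -/
def hodgeCharacter (hHD : exists_isReal_hodgeModel) (hI : hodgePQ_independent_of_hodgeModel)
    (τ : EndField B hF →+* ℂ) :
    (BettiUniverse.hodge hHD (AbelianVariety.isSmoothProjective_holds (A := B)) 1).endAlg →+* ℂ :=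
  τ.comp (endFieldAlgEquivEndAlg hF hHD hI).symm.toRingEquiv.toRingHom

/-- `hodgeCharacter τ (e^*) = τ e`. [cite: Deligne1982HodgeCycles, §4 p. 30] -/
@[simp]
theorem hodgeCharacter_apply (hHD : exists_isReal_hodgeModel) (hI : hodgePQ_independent_of_hodgeModel)
    (τ : EndField B hF →+* ℂ) (e : EndField B hF) :
    hodgeCharacter hF hHD hI τ (endFieldAlgEquivEndAlg hF hHD hI e) = τ e := by
  simp [hodgeCharacter]

/-- **The eigenblock of `hodgeCharacter τ` is the joint `τ`-eigenspace `V_τ` of `E` on `H¹ ⊗ ℂ`**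
(«`e ∈ E` acts on `H¹_{B,σ}` as `σ e`»). [cite: Deligne1982HodgeCycles, §4 p. 30] -/
theorem eigenBlock_hodgeCharacter (hHD : exists_isReal_hodgeModel)
    (hI : hodgePQ_independent_of_hodgeModel) (τ : EndField B hF →+* ℂ) :
    (BettiUniverse.hodge hHD (AbelianVariety.isSmoothProjective_holds (A := B)) 1).eigenBlock
        (hodgeCharacter hF hHD hI τ) =
      ⨅ e : EndField B hF, Module.End.eigenspace
        ((hOneAlgHom (EndField.toEndAlgebra hF).toRingHom e).baseChange ℂ) (τ e) := by
  ext x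
  rw [mem_eigenBlock_iff, Submodule.mem_iInf]
  simp only [Module.End.mem_eigenspace_iff]
  constructor
  · intro h e
    have h1 := h (endFieldAlgEquivEndAlg hF hHD hI e)
    rwa [hodgeCharacter_apply, coe_endFieldAlgEquivEndAlg_apply] at h1
  · intro h a
    obtain ⟨e, rfl⟩ := (endFieldAlgEquivEndAlg hF hHD hI).surjective a
    rw [hodgeCharacter_apply, coe_endFieldAlgEquivEndAlg_apply]
    exact h e

/-- **`H¹ ⊗ ℂ = ⊕_τ V_τ` is an internal direct sum** over the embeddings `τ : E → ℂ` (independence: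
the `V_τ` lie in eigenspaces of a primitive element of `E` for pairwise distinct eigenvalues;
spanning: every Hodge piece is the sum of its `τ`-eigenspaces, `EndAction.iSup_eigenPiece_holds`).
Hazama 1983 §3: `H¹(A, ℂ) = V₁ ⊕ ⋯ ⊕ V_k`; Deligne §4: `H¹_B ⊗ ℂ = ⊕_σ H¹_{B,σ}`.
[cite: Hazama1983, §3 (p. 305)] [cite: Deligne1982HodgeCycles, §4 p. 30] -/
theorem isInternal_eigenBlock_hodgeCharacter (hHD : exists_isReal_hodgeModel)
    (hI : hodgePQ_independent_of_hodgeModel) [DecidableEq (EndField B hF →+* ℂ)] :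
    DirectSum.IsInternal fun τ : EndField B hF →+* ℂ =>
      (BettiUniverse.hodge hHD (AbelianVariety.isSmoothProjective_holds (A := B)) 1).eigenBlock
        (hodgeCharacter hF hHD hI τ) := by
  set A := hOneEndAction (EndField.toEndAlgebra hF).toRingHom hHD hI (A := B) with hA
  have hfun : (fun τ : EndField B hF →+* ℂ =>
      (BettiUniverse.hodge hHD (AbelianVariety.isSmoothProjective_holds (A := B)) 1).eigenBlock
        (hodgeCharacter hF hHD hI τ)) =
      fun τ => ⨅ e : EndField B hF, Module.End.eigenspace ((A.ι e).baseChange ℂ) (τ e) := by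
    funext τ
    rw [eigenBlock_hodgeCharacter]
    rfl
  rw [hfun]
  refine DirectSum.isInternal_submodule_of_iSupIndep_of_iSup_eq_top ?_ ?_
  · obtain ⟨α, hα⟩ := exists_primitive_element_of_numberField (EndField B hF)
    exact ((Module.End.eigenspaces_iSupIndep ((A.ι α).baseChange ℂ)).comp
      (EndAction.complexEmbedding_apply_injective_of_adjoin_eq_top hα)).mono fun τ =>
        iInf_le (fun e => Module.End.eigenspace ((A.ι e).baseChange ℂ) (τ e)) α
  · rw [eq_top_iff, ← iSup_piece_eq_top_holds
      (BettiUniverse.hodge hHD (AbelianVariety.isSmoothProjective_holds (A := B)) 1)]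
    refine iSup_le fun p => ?_
    rw [← EndAction.iSup_eigenPiece_holds A p _]
    refine iSup_mono fun τ => fun x hx => ?_
    exact (A.mem_iInf_eigenspace_iff τ x).2 ((A.mem_eigenPiece_iff τ p _ x).1 hx).2

/-- **Each block `V_τ` is two-dimensional** when `[E : ℚ] = dim B`:
`dim_ℂ V_τ · [E:ℚ] = dim_ℚ H¹ = 2 dim B` (`EndAction.finrank_iInf_eigenspace_mul_finrank`,
`finrank_bettiCohomology_one`). Hazama 1983 §3: «`dim_ℂ V_i = 2` for all `i`».
[cite: Hazama1983, §3 (p. 306)] [cite: Deligne1982HodgeCycles, §4 p. 30] -/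
theorem finrank_eigenBlock_hodgeCharacter (hHD : exists_isReal_hodgeModel)
    (hI : hodgePQ_independent_of_hodgeModel) (hdeg : Module.finrank ℚ B.endAlgebra = B.dim)
    (τ : EndField B hF →+* ℂ) :
    Module.finrank ℂ
      ((BettiUniverse.hodge hHD (AbelianVariety.isSmoothProjective_holds (A := B)) 1).eigenBlock
        (hodgeCharacter hF hHD hI τ)) = 2 := by
  haveI : FiniteDimensional ℚ (bettiCohomology B.X 1) := finite_bettiCohomology_one B
  rw [eigenBlock_hodgeCharacter]
  have h : Module.finrank ℂ ↥(⨅ e : EndField B hF, Module.End.eigenspace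
      ((hOneAlgHom (EndField.toEndAlgebra hF).toRingHom e).baseChange ℂ) (τ e)) *
      Module.finrank ℚ (EndField B hF) = Module.finrank ℚ (bettiCohomology B.X 1) :=
    (hOneEndAction (EndField.toEndAlgebra hF).toRingHom hHD hI (A := B)).finrank_iInf_eigenspace_mul_finrank τ
  rw [finrank_bettiCohomology_one, EndField.finrank_eq, hdeg] at h
  exact Nat.eq_of_mul_eq_mul_right (dim_pos_of_finrank_eq hF hdeg) h

/-- **For `E` totally real the characters `hodgeCharacter τ` are real.** [cite: Hazama1983, §3 (p. 305)] -/
theorem hodgeCharacter_isReal (hHD : exists_isReal_hodgeModel) (hI : hodgePQ_independent_of_hodgeModel)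
    [IsTotallyReal (EndField B hF)] (τ : EndField B hF →+* ℂ) :
    (starRingEnd ℂ).comp (hodgeCharacter hF hHD hI τ) = hodgeCharacter hF hHD hI τ := by
  ext a
  obtain ⟨e, rfl⟩ := (endFieldAlgEquivEndAlg hF hHD hI).surjective a
  rw [RingHom.comp_apply, hodgeCharacter_apply]
  have h := RingHom.congr_fun
    (ComplexEmbedding.isReal_iff.1 (IsTotallyReal.complexEmbedding_isReal τ)) e
  rwa [ComplexEmbedding.conjugate_coe_eq] at h

/-! ### §4 The Lie algebra of the Hodge group -/

-- The instance hypothesis `[Module.Finite ℚ (bettiCohomology B.X 1)]` of the statements below (needed to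
-- MENTION `hodgeLie`) is supplied by consumers with `haveI := finite_bettiCohomology_one B` (tree
-- convention of `HodgeTheory/CMBettiMumfordTateNorm`, `CMBettiModel`).

/-- **Theorem (Hazama 1983 Thm. (1.1)/§3; Ribet 1983: `Hg(B) = R_{E/ℚ} SL_{2,E} = Sp_E(H¹, ψ)`, Lie
algebra form).** Let `B` be a complex abelian variety whose endomorphism algebra `End⁰(B)` is a totally
real field `E` of degree `dim B`, and `ψ` ANY polarization of the weight-one Hodge structure
`H¹(B(ℂ); ℚ)`. A `ℚ`-linear endomorphism `X` of `H¹(B(ℂ); ℚ)` lies in the Lie algebra of the Hodge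
group of `B` if and only if it commutes with every `e^*`, `e ∈ E`, and is `ψ`-skew:
`Lie Hg(B) = 𝔰𝔭_E(H¹(B(ℂ); ℚ), ψ)` («𝔥 = 𝔰𝔩₂ × ⋯ × 𝔰𝔩₂ (k times) where the i-th component acts on
V_i ⊕ ⋯ ⊕ V_i diagonally», Hazama p. 306 with `s = 1`, `k = g`). The tree theorem
`HodgeStructure.mem_hodgeLie_iff_commute_and_skew` applied to §1–§3.
[cite: Hazama1983, Thm. (1.1) and §3 (pp. 305–306)] [cite: Ribet1983, Thm. 0–1]
[cite: MoonenZarhin1999LowDim, §3 (3.1)] -/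
theorem mem_hodgeLie_hodge_one_iff_of_isTotallyReal [HodgeTensorFacts.{0, 0}]
    [Module.Finite ℚ (bettiCohomology B.X 1)]
    (hHD : exists_isReal_hodgeModel) (hI : hodgePQ_independent_of_hodgeModel)
    [IsTotallyReal (EndField B hF)] (hdeg : Module.finrank ℚ B.endAlgebra = B.dim)
    (ψ : (BettiUniverse.hodge hHD (AbelianVariety.isSmoothProjective_holds (A := B)) 1).Polarization)
    (X : Module.End ℚ (bettiCohomology B.X 1)) :
    X ∈ (BettiUniverse.hodge hHD (AbelianVariety.isSmoothProjective_holds (A := B)) 1).hodgeLie ↔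
      (∀ e : EndField B hF,
        X * hOneAlgHom (EndField.toEndAlgebra hF).toRingHom e =
          hOneAlgHom (EndField.toEndAlgebra hF).toRingHom e * X) ∧
      (∀ v w, ψ.form (X v) w + ψ.form v (X w) = 0) := by
  classical
  have hodd : Odd (((1 : ℕ) : ℤ)) := ⟨0, by norm_num⟩
  rw [mem_hodgeLie_iff_commute_and_skew
    (BettiUniverse.hodge hHD (AbelianVariety.isSmoothProjective_holds (A := B)) 1) hodd ψ
    (isAdjointPair_self_of_isTotallyReal hF hHD hI (dim_pos_of_finrank_eq hF hdeg) ψ)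
    (hodgeCharacter hF hHD hI) (hodgeCharacter_isReal hF hHD hI)
    (isInternal_eigenBlock_hodgeCharacter hF hHD hI) (finrank_eigenBlock_hodgeCharacter hF hHD hI hdeg) X]
  refine and_congr ⟨fun h e => h (endFieldAlgEquivEndAlg hF hHD hI e), fun h a => ?_⟩ Iff.rfl
  obtain ⟨e, rfl⟩ := (endFieldAlgEquivEndAlg hF hHD hI).surjective a
  exact h e

/-- **Complexified form: `Lie Hg(B) ⊗ ℂ = ⊕_τ 𝔰𝔭(V_τ, ψ_ℂ) = ⊕_τ 𝔰𝔩(V_τ)`.** A `ℂ`-linear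
endomorphism of `H¹(B(ℂ); ℚ) ⊗ ℂ` lies in the complexified Lie algebra of the Hodge group iff it
commutes with every `e^* ⊗ ℂ` and is `ψ_ℂ`-skew (Hazama 1983 §3: «`p_i(𝔥) = 𝔰𝔩₂`», «𝔥 = 𝔰𝔩₂ × ⋯ × 𝔰𝔩₂»).
[cite: Hazama1983, §3 (pp. 305–306)] [cite: Ribet1983, Thm. 0–1] -/
theorem mem_hodgeLieC_hodge_one_iff_of_isTotallyReal [HodgeTensorFacts.{0, 0}]
    [Module.Finite ℚ (bettiCohomology B.X 1)]
    (hHD : exists_isReal_hodgeModel) (hI : hodgePQ_independent_of_hodgeModel)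
    [IsTotallyReal (EndField B hF)] (hdeg : Module.finrank ℚ B.endAlgebra = B.dim)
    (ψ : (BettiUniverse.hodge hHD (AbelianVariety.isSmoothProjective_holds (A := B)) 1).Polarization)
    (Y : Module.End ℂ (ℂ ⊗[ℚ] bettiCohomology B.X 1)) :
    Y ∈ (BettiUniverse.hodge hHD (AbelianVariety.isSmoothProjective_holds (A := B)) 1).hodgeLieC ↔
      (∀ e : EndField B hF,
        Y * (hOneAlgHom (EndField.toEndAlgebra hF).toRingHom e).baseChange ℂ =
          (hOneAlgHom (EndField.toEndAlgebra hF).toRingHom e).baseChange ℂ * Y) ∧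
      (∀ x y, ψ.form.baseChange ℂ (Y x) y + ψ.form.baseChange ℂ x (Y y) = 0) := by
  classical
  have hodd : Odd (((1 : ℕ) : ℤ)) := ⟨0, by norm_num⟩
  rw [mem_hodgeLieC_iff_commute_and_skew
    (BettiUniverse.hodge hHD (AbelianVariety.isSmoothProjective_holds (A := B)) 1) hodd ψ
    (isAdjointPair_self_of_isTotallyReal hF hHD hI (dim_pos_of_finrank_eq hF hdeg) ψ)
    (hodgeCharacter hF hHD hI) (hodgeCharacter_isReal hF hHD hI)
    (isInternal_eigenBlock_hodgeCharacter hF hHD hI) (finrank_eigenBlock_hodgeCharacter hF hHD hI hdeg) Y]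
  refine and_congr ⟨fun h e => h (endFieldAlgEquivEndAlg hF hHD hI e), fun h a => ?_⟩ Iff.rfl
  obtain ⟨e, rfl⟩ := (endFieldAlgEquivEndAlg hF hHD hI).surjective a
  exact h e

/-- **Block form: an endomorphism of `H¹ ⊗ ℂ` preserving every joint eigenspace `V_τ` of `E` and skew
for `ψ_ℂ` lies in `Lie Hg(B) ⊗ ℂ`, and conversely** (`Lie Hg(B)_ℂ ⊇ 𝔰𝔩(V_τ)` placed at any one `τ`: the
form consumed by the invariant theory per place). [cite: Hazama1983, §3 (pp. 305–306)] [cite: Ribet1983, Thm. 0–1] -/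
theorem mem_hodgeLieC_hodge_one_iff_mapsTo_of_isTotallyReal [HodgeTensorFacts.{0, 0}]
    [Module.Finite ℚ (bettiCohomology B.X 1)]
    (hHD : exists_isReal_hodgeModel) (hI : hodgePQ_independent_of_hodgeModel)
    [IsTotallyReal (EndField B hF)] (hdeg : Module.finrank ℚ B.endAlgebra = B.dim)
    (ψ : (BettiUniverse.hodge hHD (AbelianVariety.isSmoothProjective_holds (A := B)) 1).Polarization)
    (Y : Module.End ℂ (ℂ ⊗[ℚ] bettiCohomology B.X 1)) :
    Y ∈ (BettiUniverse.hodge hHD (AbelianVariety.isSmoothProjective_holds (A := B)) 1).hodgeLieC ↔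
      (∀ τ : EndField B hF →+* ℂ, Set.MapsTo Y
        (⨅ e : EndField B hF, Module.End.eigenspace
          ((hOneAlgHom (EndField.toEndAlgebra hF).toRingHom e).baseChange ℂ) (τ e) : Submodule ℂ _)
        (⨅ e : EndField B hF, Module.End.eigenspace
          ((hOneAlgHom (EndField.toEndAlgebra hF).toRingHom e).baseChange ℂ) (τ e) : Submodule ℂ _)) ∧
      (∀ x y, ψ.form.baseChange ℂ (Y x) y + ψ.form.baseChange ℂ x (Y y) = 0) := by
  classical
  have hodd : Odd (((1 : ℕ) : ℤ)) := ⟨0, by norm_num⟩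
  rw [mem_hodgeLieC_iff_mapsTo_and_skew
    (BettiUniverse.hodge hHD (AbelianVariety.isSmoothProjective_holds (A := B)) 1) hodd ψ
    (isAdjointPair_self_of_isTotallyReal hF hHD hI (dim_pos_of_finrank_eq hF hdeg) ψ)
    (hodgeCharacter hF hHD hI) (hodgeCharacter_isReal hF hHD hI)
    (isInternal_eigenBlock_hodgeCharacter hF hHD hI) (finrank_eigenBlock_hodgeCharacter hF hHD hI hdeg) Y]
  simp only [eigenBlock_hodgeCharacter]

end RealMultiplication

end Literature.AlgebraicGeometry.HodgeTheory

end
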